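import Literature.Geometry.Lorentzian.CoordScalarCurvatureFirstVariation
import Literature.Geometry.Lorentzian.CoordBochner
import Literature.Geometry.Lorentzian.CoordRicciEvolution
import HarnessLib

/-!
# The linearised scalar curvature, its formal adjoint and the Green identity (Fischer–Marsden)

Everything here is PROVED; the file introduces five explicit definitions (`divFormVec`,
`linScalVec`, `linScalAt`, `adjScalAt`, `greenVec`) and no statement of `Prop` type.

In the coordinate tensor calculus of metric components `G : E → (E →L E →L ℝ)`
(`MetricCoord.IsMetricOn G V`, any signature; `chrAt`, `ricAt`, `cov₂At`, `mtrAt`, `pairAt`,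
`hessAt`, `lapAt`, `divAt`), for a smooth symmetric `2`-tensor field `h` and a smooth function
`f` on `V`:

* `IsMetricOn.divAt_sharpAt` — `div(θ^♯) = Σ g^{kl}(∂_{b_k}θ(b_l) − θ(Γ(b_k,b_l)))` for a field of
  covectors `θ` (`∇♯ = ♯∇`), and `divAt_sharpAt_fderiv` — `div grad φ = Δφ`;
* `divFormVec b G h` — `(div_G h)^♯`, with `apply_divFormVec`: `G((div_G h)^♯, Z) = Σ g^{kl}(∇_{b_k}h)(b_l, Z)`;
* `linScalAt b G h x` — the **linearised scalar curvature**
  `DS_G(h) = −⟨h, Ric⟩_G + div W_h − ½ Δ_G tr_G h`, `W_h = (div_G h)^♯ − ½ ∇ tr_G h` (`linScalVec`),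
  i.e. `div_G div_G h − Δ_G tr_G h − ⟨h, Ric⟩_G` (Besse 1987, Thm. 1.174 (e), whose `Δ_g = −Δ_G`,
  `δ_g = −div_G`); `IsMetricFamilyOn.hasDerivWithinAt_scalAt_linScalAt` — along a smooth family
  of metrics `∂_t S(G_t) = DS_{G_t}(∂_t G_t)` (from `CoordScalarCurvatureFirstVariation` and
  `varChrTrace_eq_linScalVec`);
* `adjScalAt G f x` — the **formal `L²`-adjoint** `DS*_G(f) = −(Δ_G f) G + Hess f − f Ric`
  (Besse 1987, 4.64 ff.; Fischer–Marsden 1975; Corvino 2000, (3): `L_g^* f = −(Δ_g f) g + Hess f − f Ric(g)`);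
* `IsMetricOn.mul_linScalAt_sub_pairAt_adjScalAt` — the **Green identity**
  `f · DS_G(h) − ⟨DS*_G f, h⟩_G = div_G B` with the explicit boundary field
  `B = f((div_G h)^♯ − ∇ tr_G h) − (h(∇f,·))^♯ + (tr_G h) ∇f` (`greenVec`); in particular
  `DS*_G f = 0` (a static potential) makes `f · DS_G(h)` an exact divergence (Corvino 2000, Prop. 2.3
  and (5); the origin of the cokernel in Corvino–Schoen gluing).

## References

* A. L. Besse, *Einstein manifolds*, Springer 1987, 1.59, Thm. 1.174, 1.181, 4.64. [Besse1987]
* A. E. Fischer, J. E. Marsden, *Deformations of the scalar curvature*, Duke Math. J. 42 (1975), 519–547.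
* J. Corvino, *Scalar curvature deformation and a gluing construction for the Einstein constraint
  equations*, Comm. Math. Phys. 214 (2000), §2, (3)–(5), Prop. 2.3. [Corvino2000]
* B. O'Neill, *Semi-Riemannian geometry*, 1983, Ch. 3, p. 86 and Def. 3.50. [ONeill1983]
-/

noncomputable section

set_option maxSynthPendingDepth 3

open Set Filter ContinuousLinearMap Module
open scoped Topology ContDiff

namespace Literature.Geometry.Lorentzian

namespace MetricCoord

variable {E : Type*} [NormedAddCommGroup E] [NormedSpace ℝ E]
variable {ι : Type*} [Fintype ι] [FiniteDimensional ℝ E] [CompleteSpace E] (b : Basis ι ℝ E)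
  {G : E → E →L[ℝ] E →L[ℝ] ℝ} {V : Set E} {x : E}

/-- **The divergence of a metrically raised one-form**: for a field of covectors `θ`
differentiable at `x ∈ V`, `div (θ^♯)(x) = Σ_{kl} g^{kl} (∇_{b_k} θ)(b_l)
= Σ_{kl} g^{kl} (∂_{b_k} θ(b_l) − θ(Γ(b_k, b_l)))` (`∇♯ = ♯∇`: O'Neill 1983, Ch. 3, p. 86,
contraction commutes with the Levi-Civita covariant derivative; with `θ = df` this is
`div grad f = Δf`). [cite: ONeill1983, Ch. 3, p. 86] -/
theorem IsMetricOn.divAt_sharpAt (hG : IsMetricOn G V) (hx : x ∈ V) {θ : E → E →L[ℝ] ℝ}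
    (hθ : DifferentiableAt ℝ θ x) :
    divAt G (fun y ↦ sharpAt G y (θ y)) x =
      ∑ k, ∑ l, ginv G b x k l * (fderiv ℝ θ x (b k) (b l) - θ x (chrAt G x (b k) (b l))) := by
  have hi := hG.isInvertible x hx
  have hT := hG.fderiv_symm hx
  have hgs : ∀ k l, ginv G b x k l = ginv G b x l k := fun k l ↦ ginv_comm b hi (hG.symm x hx) k l
  set v := sharpAt G x (θ x) with hv
  -- the derivative of `y ↦ ♯_y θ_y`
  have hD : HasFDerivAt (fun y ↦ sharpAt G y (θ y))
      ((sharpAt G x).comp (fderiv ℝ θ x) + (fderiv ℝ (sharpAt G) x).flip (θ x)) x :=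
    (hG.differentiableAt_sharpAt hx).hasFDerivAt.clm_apply hθ.hasFDerivAt
  have hDapp : ∀ X, fderiv ℝ (fun y ↦ sharpAt G y (θ y)) x X =
      sharpAt G x (fderiv ℝ θ x X) + -sharpAt G x (fderiv ℝ G x X v) := by
    intro X
    rw [hD.fderiv, _root_.add_apply, ContinuousLinearMap.flip_apply, hG.fderiv_sharpAt hx X,
      ContinuousLinearMap.comp_apply]
    simp only [_root_.neg_apply, ContinuousLinearMap.comp_apply, hv]
  -- `θ = G(v, ·)`
  have hθv : ∀ w, θ x w = G x v w := fun w ↦ (apply_sharpAt_apply hi (θ x) w).symm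
  rw [divAt_eq, traceCLM_apply, trace_eq_sum_coord b]
  simp only [ContinuousLinearMap.coe_coe, covDAt_apply, hDapp, map_add, map_neg,
    coord_sharpAt_eq_sum b, coord_eq_sum_ginv b hi (chrAt G x _ _), apply_chrAt hi, koszulCLM_apply,
    hθv]
  -- every term is now a double sum of `g^{ij} × (derivatives of G, θ)`
  have e1 : ∑ i, ∑ j, ginv G b x i j * fderiv ℝ G x (b i) v (b j) =
      ∑ i, ∑ j, ginv G b x i j * fderiv ℝ G x (b i) (b j) v := by
    refine Finset.sum_congr rfl fun i _ ↦ Finset.sum_congr rfl fun j _ ↦ ?_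
    rw [hT (b i) v (b j)]
  have e2 : ∑ i, ∑ j, ginv G b x i j * fderiv ℝ G x (b j) v (b i) =
      ∑ i, ∑ j, ginv G b x i j * fderiv ℝ G x (b i) (b j) v := by
    rw [Finset.sum_comm]
    refine Finset.sum_congr rfl fun i _ ↦ Finset.sum_congr rfl fun j _ ↦ ?_
    rw [hgs j i, hT (b i) v (b j)]
  have e4 : ∑ k, ∑ l, ginv G b x k l * G x v (chrAt G x (b k) (b l)) =
      ∑ k, ∑ l, ginv G b x k l * (2⁻¹ * (fderiv ℝ G x (b k) (b l) v + fderiv ℝ G x (b l) v (b k)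
        - fderiv ℝ G x v (b k) (b l))) := by
    refine Finset.sum_congr rfl fun k _ ↦ Finset.sum_congr rfl fun l _ ↦ ?_
    rw [hG.symm x hx v, apply_chrAt hi, koszulCLM_apply]
  -- assemble
  have lhs : ∑ i, ((∑ j, ginv G b x i j * fderiv ℝ θ x (b i) (b j))
      + -(∑ j, ginv G b x i j * fderiv ℝ G x (b i) v (b j))
      + ∑ j, ginv G b x i j * (2⁻¹ * (fderiv ℝ G x v (b i) (b j) + fderiv ℝ G x (b i) (b j) v
          - fderiv ℝ G x (b j) v (b i)))) =
      -(∑ i, ∑ j, ginv G b x i j * fderiv ℝ G x (b i) v (b j))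
      + (∑ i, ∑ j, ginv G b x i j * fderiv ℝ θ x (b i) (b j))
      + 2⁻¹ * ((∑ i, ∑ j, ginv G b x i j * fderiv ℝ G x v (b i) (b j))
        + (∑ i, ∑ j, ginv G b x i j * fderiv ℝ G x (b i) (b j) v)
        - ∑ i, ∑ j, ginv G b x i j * fderiv ℝ G x (b j) v (b i)) := by
    simp only [Finset.sum_add_distrib, Finset.sum_neg_distrib, Finset.mul_sum, Finset.sum_sub_distrib,
      mul_add, mul_sub]
    ring
  have rhs : ∑ k, ∑ l, ginv G b x k l * (fderiv ℝ θ x (b k) (b l) - G x v (chrAt G x (b k) (b l))) =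
      (∑ k, ∑ l, ginv G b x k l * fderiv ℝ θ x (b k) (b l))
      - 2⁻¹ * ((∑ k, ∑ l, ginv G b x k l * fderiv ℝ G x (b k) (b l) v)
        + (∑ k, ∑ l, ginv G b x k l * fderiv ℝ G x (b l) v (b k))
        - ∑ k, ∑ l, ginv G b x k l * fderiv ℝ G x v (b k) (b l)) := by
    have hsplit : ∑ k, ∑ l, ginv G b x k l * (fderiv ℝ θ x (b k) (b l) - G x v (chrAt G x (b k) (b l))) =
        (∑ k, ∑ l, ginv G b x k l * fderiv ℝ θ x (b k) (b l))
        - ∑ k, ∑ l, ginv G b x k l * G x v (chrAt G x (b k) (b l)) := by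
      simp only [mul_sub, Finset.sum_sub_distrib]
    rw [hsplit, e4]
    have key : ∀ (P Q R g : ι → ι → ℝ), ∑ k, ∑ l, g k l * (2⁻¹ * (P k l + Q k l - R k l)) =
        2⁻¹ * ((∑ k, ∑ l, g k l * P k l) + (∑ k, ∑ l, g k l * Q k l) - ∑ k, ∑ l, g k l * R k l) := by
      intro P Q R g
      simp only [Finset.mul_sum, ← Finset.sum_add_distrib, ← Finset.sum_sub_distrib]
      refine Finset.sum_congr rfl fun k _ ↦ Finset.sum_congr rfl fun l _ ↦ ?_
      ring
    have t := key (fun k l ↦ fderiv ℝ G x (b k) (b l) v) (fun k l ↦ fderiv ℝ G x (b l) v (b k))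
      (fun k l ↦ fderiv ℝ G x v (b k) (b l)) (fun k l ↦ ginv G b x k l)
    rw [t]
  rw [lhs, rhs, e1, e2]
  ring

omit [Fintype ι] in
/-- **`div grad φ = Δφ`**: the divergence of the metrically raised differential is the
coordinate Laplacian (O'Neill 1983, Ch. 3, Def. 3.50 ff.). [cite: ONeill1983, Ch. 3, Def. 3.50] -/
theorem IsMetricOn.divAt_sharpAt_fderiv (hG : IsMetricOn G V) (hx : x ∈ V) {φ : E → ℝ}
    (hφ : ContDiffOn ℝ ∞ φ V) :
    divAt G (fun y ↦ sharpAt G y (fderiv ℝ φ y)) x = lapAt G φ x := by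
  have hDφ : DifferentiableAt ℝ (fderiv ℝ φ) x :=
    (contDiffAt_fderiv_of_contDiffOn hG.isOpen hφ hx).differentiableAt (by simp)
  rw [hG.divAt_sharpAt (Module.finBasis ℝ E) hx hDφ, lapAt_eq_sum G (Module.finBasis ℝ E)]

omit [CompleteSpace E] in
/-- **The pairing in a basis**: `⟨α, β⟩_G = Σ_{kl} g^{kl} α(♯β(b_k, ·), b_l)`. [folklore] -/
theorem pairAt_eq_sum_ginv (α β : E →L[ℝ] E →L[ℝ] ℝ) :
    pairAt G x α β = ∑ k, ∑ l, ginv G b x k l * α (sharpAt G x (β (b k))) (b l) := by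
  rw [pairAt_eq_sum_coord b]
  exact Finset.sum_congr rfl fun k _ ↦ coord_sharpAt_eq_sum b _ k

omit [Fintype ι] [CompleteSpace E] in
/-- `div (W − U) = div W − div U` (a private copy of the lemma of
`Riemannian/VectorFieldBochnerFormula.lean`, to keep the import cone small). [folklore] -/
private theorem divAt_sub' {W U : E → E} (hW : DifferentiableAt ℝ W x) (hU : DifferentiableAt ℝ U x) :
    divAt G (fun y ↦ W y - U y) x = divAt G W x - divAt G U x := by
  rw [divAt_eq, covDAt_sub hW hU, map_sub, divAt_eq, divAt_eq]

omit [Fintype ι] [CompleteSpace E] in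
/-- `div (W + U) = div W + div U`. [folklore] -/
theorem divAt_add {W U : E → E} (hW : DifferentiableAt ℝ W x) (hU : DifferentiableAt ℝ U x) :
    divAt G (fun y ↦ W y + U y) x = divAt G W x + divAt G U x := by
  have h : covDAt G (fun y ↦ W y + U y) x = covDAt G W x + covDAt G U x := by
    simp only [covDAt, fderiv_fun_add hW hU, map_add]
    abel
  rw [divAt_eq, h, map_add, divAt_eq, divAt_eq]

omit [Fintype ι] [CompleteSpace E] in
/-- `div (c W) = c div W` for a constant `c`. [folklore] -/
theorem divAt_const_smul {W : E → E} (hW : DifferentiableAt ℝ W x) (c : ℝ) :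
    divAt G (fun y ↦ c • W y) x = c * divAt G W x := by
  have h : covDAt G (fun y ↦ c • W y) x = c • covDAt G W x := by
    ext X
    simp only [covDAt_apply, fderiv_fun_const_smul hW, _root_.smul_apply, map_smul, smul_add]
  rw [divAt_eq, h, map_smul, smul_eq_mul, divAt_eq]

/-! ### The linearised scalar curvature, its formal adjoint, and the Green identity -/

section Adjoint

variable (G)

/-- The **metrically raised divergence of a field of bilinear forms** in the basis `b`:
`(div_G β)^♯ = Σ_{kl} g^{kl} ♯((∇_{b_k} β)(b_l, ·))`, so that `G((div_G β)^♯, Z) = Σ g^{kl}(∇_{b_k}β)(b_l, Z)`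
(`apply_divFormVec`; Besse 1987, 1.59, `δβ = −tr_{12} Dβ`, up to Besse's sign). [cite: Besse1987, 1.59] -/
def divFormVec (β : E → E →L[ℝ] E →L[ℝ] ℝ) (x : E) : E :=
  ∑ k, ∑ l, ginv G b x k l • sharpAt G x (cov₂At G β x (b k) (b l))

/-- The vector field `W_h = (div_G h)^♯ − ½ ∇(tr_G h)` of a symmetric `2`-tensor `h`
(Besse 1987, 1.174 (a) traced: the metric trace of the variation `D'_g h` of the connection).
[cite: Besse1987, Thm. 1.174 (a)] -/
def linScalVec (h : E → E →L[ℝ] E →L[ℝ] ℝ) (x : E) : E :=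
  divFormVec b G h x - (2⁻¹ : ℝ) • sharpAt G x (fderiv ℝ (fun y ↦ mtrAt G y (h y)) x)

/-- The **linearised scalar curvature** `DS_G(h) = s'_g h` of Besse 1987, Thm. 1.174 (e), in the
tree's conventions: `DS_G(h) = −⟨h, Ric⟩_G + div W_h − ½ Δ_G(tr_G h)` with
`W_h = (div_G h)^♯ − ½ ∇ tr_G h` (`= div_G div_G h − Δ_G tr_G h − ⟨h, Ric⟩_G`).
[cite: Besse1987, Thm. 1.174 (e)] -/
def linScalAt (h : E → E →L[ℝ] E →L[ℝ] ℝ) (x : E) : ℝ :=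
  -pairAt G x (h x) (ricAt G x) + divAt G (linScalVec b G h) x
    - 2⁻¹ * lapAt G (fun y ↦ mtrAt G y (h y)) x

/-- The **formal `L²`-adjoint of the linearised scalar curvature**,
`DS*_G(f) = −(Δ_G f) G + Hess f − f Ric` (Besse 1987, 1.159 (e)/(4.64): `(s'_g)* f = D df + (Δ_g f) g − f r_g`
with Besse's `Δ_g = −Δ_G`; Fischer–Marsden; Corvino 2000, (3)). [cite: Besse1987, 4.64] -/
def adjScalAt (f : E → ℝ) (x : E) : E →L[ℝ] E →L[ℝ] ℝ :=
  -(lapAt G f x) • G x + hessAt G f x - f x • ricAt G x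

/-- The **boundary vector field of the Green identity** for `DS_G`:
`B = f ((div_G h)^♯ − ∇ tr_G h) − (h(∇f, ·))^♯ + (tr_G h) ∇f`. [cite: Besse1987, 4.64] -/
def greenVec (f : E → ℝ) (h : E → E →L[ℝ] E →L[ℝ] ℝ) (x : E) : E :=
  f x • (divFormVec b G h x - sharpAt G x (fderiv ℝ (fun y ↦ mtrAt G y (h y)) x))
    - sharpAt G x (h x (sharpAt G x (fderiv ℝ f x)))
    + mtrAt G x (h x) • sharpAt G x (fderiv ℝ f x)

variable {G}

omit [CompleteSpace E] in
/-- `G((div_G β)^♯, Z) = Σ_{kl} g^{kl} (∇_{b_k} β)(b_l, Z)`. [cite: Besse1987, 1.59] -/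
theorem apply_divFormVec (hx : (G x).IsInvertible) (β : E → E →L[ℝ] E →L[ℝ] ℝ) (Z : E) :
    G x (divFormVec b G β x) Z = ∑ k, ∑ l, ginv G b x k l * cov₂At G β x (b k) (b l) Z := by
  rw [divFormVec]
  simp only [map_sum, map_smul, FunLike.coe_sum, Finset.sum_apply, FunLike.coe_smul, Pi.smul_apply,
    smul_eq_mul, apply_sharpAt_apply hx]

omit [CompleteSpace E] in
/-- `⟨DS*_G f, h⟩_G = −Δf · tr_G h + ⟨Hess f, h⟩_G − f ⟨Ric, h⟩_G`. [cite: Besse1987, 4.64] -/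
theorem pairAt_adjScalAt (hx : (G x).IsInvertible) (f : E → ℝ) (η : E →L[ℝ] E →L[ℝ] ℝ) :
    pairAt G x (adjScalAt G f x) η =
      -(lapAt G f x) * mtrAt G x η + pairAt G x (hessAt G f x) η - f x * pairAt G x (ricAt G x) η := by
  rw [adjScalAt, sub_eq_add_neg, ← neg_smul, pairAt_add_left, pairAt_add_left, pairAt_smul_left,
    pairAt_smul_left, pairAt_comm G x (G x) η, pairAt_metric_right hx]
  ring

/-- `(div_G h)^♯` is differentiable on `V`. [folklore] -/
theorem IsMetricOn.differentiableAt_divFormVec (hG : IsMetricOn G V) (hx : x ∈ V)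
    {h : E → E →L[ℝ] E →L[ℝ] ℝ} (hh : ContDiffOn ℝ ∞ h V) :
    DifferentiableAt ℝ (divFormVec b G h) x := by
  have hg : ∀ k l, DifferentiableAt ℝ (fun y ↦ ginv G b y k l) x := fun k l ↦
    ((hG.contDiffOn_ginv b k l).contDiffAt (hG.mem_nhds hx)).differentiableAt (by simp)
  have hc : DifferentiableAt ℝ (cov₂At G h) x := (hG.contDiffAt_cov₂At hx hh).differentiableAt (by simp)
  have hck : ∀ k l, DifferentiableAt ℝ (fun y ↦ cov₂At G h y (b k) (b l)) x := fun k l ↦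
    differentiableAt_clm_apply_const (differentiableAt_clm_apply_const hc (b k)) (b l)
  have hs : ∀ k l, DifferentiableAt ℝ (fun y ↦ sharpAt G y (cov₂At G h y (b k) (b l))) x := fun k l ↦
    (hG.differentiableAt_sharpAt hx).clm_apply (hck k l)
  have heq : divFormVec b G h = fun y ↦ ∑ k, ∑ l, ginv G b y k l • sharpAt G y (cov₂At G h y (b k) (b l)) :=
    rfl
  rw [heq]
  exact DifferentiableAt.fun_sum fun k _ ↦ DifferentiableAt.fun_sum fun l _ ↦ (hg k l).smul (hs k l)

/-- **The divergence of the contraction `(h(∇f, ·))^♯`**: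
`div ((h(∇f,·))^♯) = G((div_G h)^♯, ∇f) + ⟨h, Hess f⟩_G` for a smooth symmetric `h`
(Leibniz rule and `∇♯ = ♯∇`). [cite: Besse1987, 4.64] -/
theorem IsMetricOn.divAt_sharpAt_contract (hG : IsMetricOn G V) (hx : x ∈ V) {f : E → ℝ}
    (hf : ContDiffOn ℝ ∞ f V) {h : E → E →L[ℝ] E →L[ℝ] ℝ} (hh : ContDiffOn ℝ ∞ h V)
    (hs : ∀ y ∈ V, ∀ v w, h y v w = h y w v) :
    divAt G (fun y ↦ sharpAt G y (h y (sharpAt G y (fderiv ℝ f y)))) x =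
      G x (divFormVec b G h x) (sharpAt G x (fderiv ℝ f x)) + pairAt G x (h x) (hessAt G f x) := by
  have hi := hG.isInvertible x hx
  have hhd : DifferentiableAt ℝ h x := ((hh x hx).contDiffAt (hG.mem_nhds hx)).differentiableAt (by simp)
  have hgrad := hG.hasFDerivAt_sharpAt_fderiv hx hf
  -- the covector field `θ = h(∇f, ·)` and its derivative
  have hθ : HasFDerivAt (fun y ↦ h y (sharpAt G y (fderiv ℝ f y)))
      ((h x).comp ((sharpAt G x).comp (fderiv ℝ (fderiv ℝ f) x) +
        (fderiv ℝ (sharpAt G) x).flip (fderiv ℝ f x))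
        + (fderiv ℝ h x).flip (sharpAt G x (fderiv ℝ f x))) x :=
    hhd.hasFDerivAt.clm_apply hgrad
  have hθD : ∀ X w, fderiv ℝ (fun y ↦ h y (sharpAt G y (fderiv ℝ f y))) x X w =
      h x (sharpAt G x (hessAt G f x X) - chrAt G x X (sharpAt G x (fderiv ℝ f x))) w
        + fderiv ℝ h x X (sharpAt G x (fderiv ℝ f x)) w := by
    intro X w
    have happ := hG.fderiv_sharpAt_fderiv_apply hx hf X
    rw [hgrad.fderiv] at happ
    rw [hθ.fderiv, _root_.add_apply, ContinuousLinearMap.comp_apply, happ, flip_apply, _root_.add_apply]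
  rw [hG.divAt_sharpAt b hx hθ.differentiableAt, apply_divFormVec b hi, pairAt_eq_sum_ginv b]
  simp only [hθD, cov₂At_apply, map_sub, _root_.sub_apply]
  -- symmetry of `∇h` in the last two slots and of `h`
  have hsx := hs x hx
  have hcs : ∀ k l, fderiv ℝ h x (b k) (b l) (sharpAt G x (fderiv ℝ f x))
      - h x (chrAt G x (b k) (b l)) (sharpAt G x (fderiv ℝ f x))
      - h x (b l) (chrAt G x (b k) (sharpAt G x (fderiv ℝ f x))) =
      fderiv ℝ h x (b k) (sharpAt G x (fderiv ℝ f x)) (b l)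
      - h x (chrAt G x (b k) (sharpAt G x (fderiv ℝ f x))) (b l)
      - h x (sharpAt G x (fderiv ℝ f x)) (chrAt G x (b k) (b l)) := by
    intro k l
    have hsev : ∀ᶠ y in 𝓝 x, ∀ v w, h y v w = h y w v :=
      (hG.eventually_mem hx).mono fun y hy ↦ hs y hy
    have h1 := cov₂At_symm (G := G) hhd hsev (b k) (b l) (sharpAt G x (fderiv ℝ f x))
    simp only [cov₂At_apply] at h1
    exact h1
  simp only [hcs]
  rw [← Finset.sum_add_distrib]
  refine Finset.sum_congr rfl fun k _ ↦ ?_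
  rw [← Finset.sum_add_distrib]
  refine Finset.sum_congr rfl fun l _ ↦ ?_
  rw [hsx (sharpAt G x (fderiv ℝ f x)) (chrAt G x (b k) (b l))]
  ring

/-- **The Green identity for the linearised scalar curvature** (Fischer–Marsden; Besse 1987,
4.64; Corvino 2000, (3) and Prop. 2.7): for a smooth symmetric `2`-tensor field `h` and a
smooth function `f` on `V`, pointwise on `V`,

  `f · DS_G(h) − ⟨DS*_G f, h⟩_G = div_G B`,  `B = f ((div_G h)^♯ − ∇ tr_G h) − (h(∇f,·))^♯ + (tr_G h) ∇f`

(`greenVec`). [cite: Besse1987, 4.64] -/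
theorem IsMetricOn.mul_linScalAt_sub_pairAt_adjScalAt (hG : IsMetricOn G V) (hx : x ∈ V)
    {f : E → ℝ} (hf : ContDiffOn ℝ ∞ f V) {h : E → E →L[ℝ] E →L[ℝ] ℝ} (hh : ContDiffOn ℝ ∞ h V)
    (hs : ∀ y ∈ V, ∀ v w, h y v w = h y w v) :
    f x * linScalAt b G h x - pairAt G x (adjScalAt G f x) (h x) = divAt G (greenVec b G f h) x := by
  have hi := hG.isInvertible x hx
  have hGs := hG.symm x hx
  -- smoothness of the ingredients
  have hfA : ContDiffAt ℝ ∞ f x := contDiffAt_of_contDiffOn hG.isOpen hf hx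
  have hfd : DifferentiableAt ℝ f x := hfA.differentiableAt (by simp)
  have hDf : DifferentiableAt ℝ (fderiv ℝ f) x :=
    (contDiffAt_fderiv_of_contDiffOn hG.isOpen hf hx).differentiableAt (by simp)
  have hτ : ContDiffOn ℝ ∞ (fun y ↦ mtrAt G y (h y)) V := hG.contDiffOn_mtrAt hh
  have hτA : ContDiffAt ℝ ∞ (fun y ↦ mtrAt G y (h y)) x := contDiffAt_of_contDiffOn hG.isOpen hτ hx
  have hτd : DifferentiableAt ℝ (fun y ↦ mtrAt G y (h y)) x := hτA.differentiableAt (by simp)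
  have hDτ : DifferentiableAt ℝ (fderiv ℝ (fun y ↦ mtrAt G y (h y))) x :=
    (contDiffAt_fderiv_of_contDiffOn hG.isOpen hτ hx).differentiableAt (by simp)
  have hhd : DifferentiableAt ℝ h x := ((hh x hx).contDiffAt (hG.mem_nhds hx)).differentiableAt (by simp)
  have hsh := hG.differentiableAt_sharpAt hx
  have hU₁ := hG.differentiableAt_divFormVec b hx hh
  have hU₂ : DifferentiableAt ℝ (fun y ↦ sharpAt G y (fderiv ℝ (fun y ↦ mtrAt G y (h y)) y)) x :=
    hsh.clm_apply hDτ
  have hU : DifferentiableAt ℝ (fun y ↦ divFormVec b G h y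
      - sharpAt G y (fderiv ℝ (fun y ↦ mtrAt G y (h y)) y)) x := hU₁.sub hU₂
  have hgradd : DifferentiableAt ℝ (fun y ↦ sharpAt G y (fderiv ℝ f y)) x := hsh.clm_apply hDf
  have hθd : DifferentiableAt ℝ (fun y ↦ sharpAt G y (h y (sharpAt G y (fderiv ℝ f y)))) x :=
    hsh.clm_apply (hhd.clm_apply hgradd)
  -- the divergences of the pieces
  have dU : divAt G (fun y ↦ divFormVec b G h y - sharpAt G y (fderiv ℝ (fun y ↦ mtrAt G y (h y)) y)) x =
      divAt G (divFormVec b G h) x - lapAt G (fun y ↦ mtrAt G y (h y)) x := by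
    rw [divAt_sub' hU₁ hU₂, hG.divAt_sharpAt_fderiv hx hτ]
  have dW : divAt G (linScalVec b G h) x =
      divAt G (divFormVec b G h) x - 2⁻¹ * lapAt G (fun y ↦ mtrAt G y (h y)) x := by
    have hU₂c : DifferentiableAt ℝ
        (fun y ↦ (2⁻¹ : ℝ) • sharpAt G y (fderiv ℝ (fun y ↦ mtrAt G y (h y)) y)) x := hU₂.const_smul _
    rw [show linScalVec b G h = fun y ↦ divFormVec b G h y
        - (2⁻¹ : ℝ) • sharpAt G y (fderiv ℝ (fun y ↦ mtrAt G y (h y)) y) from rfl,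
      divAt_sub' hU₁ hU₂c, divAt_const_smul hU₂, hG.divAt_sharpAt_fderiv hx hτ]
  have d1 : divAt G (fun y ↦ f y • (divFormVec b G h y
      - sharpAt G y (fderiv ℝ (fun y ↦ mtrAt G y (h y)) y))) x =
      f x * (divAt G (divFormVec b G h) x - lapAt G (fun y ↦ mtrAt G y (h y)) x)
        + (fderiv ℝ f x (divFormVec b G h x)
          - fderiv ℝ f x (sharpAt G x (fderiv ℝ (fun y ↦ mtrAt G y (h y)) x))) := by
    rw [divAt_smul hfd hU, dU, map_sub]
  have d2 := hG.divAt_sharpAt_contract b hx hf hh hs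
  have d3 : divAt G (fun y ↦ mtrAt G y (h y) • sharpAt G y (fderiv ℝ f y)) x =
      mtrAt G x (h x) * lapAt G f x
        + fderiv ℝ (fun y ↦ mtrAt G y (h y)) x (sharpAt G x (fderiv ℝ f x)) := by
    rw [divAt_smul hτd hgradd, hG.divAt_sharpAt_fderiv hx hf]
  -- assemble `div B`
  have dB : divAt G (greenVec b G f h) x =
      (f x * (divAt G (divFormVec b G h) x - lapAt G (fun y ↦ mtrAt G y (h y)) x)
        + (fderiv ℝ f x (divFormVec b G h x)
          - fderiv ℝ f x (sharpAt G x (fderiv ℝ (fun y ↦ mtrAt G y (h y)) x))))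
      - (G x (divFormVec b G h x) (sharpAt G x (fderiv ℝ f x)) + pairAt G x (h x) (hessAt G f x))
      + (mtrAt G x (h x) * lapAt G f x
        + fderiv ℝ (fun y ↦ mtrAt G y (h y)) x (sharpAt G x (fderiv ℝ f x))) := by
    rw [show greenVec b G f h = fun y ↦ (f y • (divFormVec b G h y
        - sharpAt G y (fderiv ℝ (fun y ↦ mtrAt G y (h y)) y))
        - sharpAt G y (h y (sharpAt G y (fderiv ℝ f y))))
        + mtrAt G y (h y) • sharpAt G y (fderiv ℝ f y) from rfl]
    have hP0 : DifferentiableAt ℝ (fun y ↦ f y • (divFormVec b G h y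
        - sharpAt G y (fderiv ℝ (fun y ↦ mtrAt G y (h y)) y))) x := hfd.smul hU
    have hP1 : DifferentiableAt ℝ (fun y ↦ f y • (divFormVec b G h y
        - sharpAt G y (fderiv ℝ (fun y ↦ mtrAt G y (h y)) y))
        - sharpAt G y (h y (sharpAt G y (fderiv ℝ f y)))) x := hP0.sub hθd
    have hP2 : DifferentiableAt ℝ (fun y ↦ mtrAt G y (h y) • sharpAt G y (fderiv ℝ f y)) x :=
      hτd.smul hgradd
    rw [divAt_add hP1 hP2, divAt_sub' hP0 hθd, d1, d2, d3]
  -- duality `α(v) = G(♯α, v)` for the cross terms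
  have e1 : fderiv ℝ f x (divFormVec b G h x) = G x (divFormVec b G h x) (sharpAt G x (fderiv ℝ f x)) := by
    rw [hGs, apply_sharpAt_apply hi]
  have e2 : fderiv ℝ f x (sharpAt G x (fderiv ℝ (fun y ↦ mtrAt G y (h y)) x)) =
      fderiv ℝ (fun y ↦ mtrAt G y (h y)) x (sharpAt G x (fderiv ℝ f x)) := by
    rw [← apply_sharpAt_apply hi (fderiv ℝ f x) (sharpAt G x _), hGs, apply_sharpAt_apply hi]
  rw [dB, linScalAt, dW, pairAt_adjScalAt hi, pairAt_comm G x (hessAt G f x) (h x),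
    pairAt_comm G x (ricAt G x) (h x), e1, e2]
  ring

end Adjoint

/-! ### Link with the first variation along a family -/

omit [Fintype ι] [CompleteSpace E] in
/-- `divAt` only depends on the germ of the vector field (cf.
`divAt_congr_of_eventuallyEq` in `Riemannian/CurvatureAsDivergence.lean`). [folklore] -/
private theorem divAt_congr' {W U : E → E} (h : W =ᶠ[𝓝 x] U) : divAt G W x = divAt G U x := by
  rw [divAt_eq, divAt_eq, covDAt, covDAt, h.fderiv_eq, h.self_of_nhds]

namespace IsMetricFamilyOn

variable {G' : ℝ → E → E →L[ℝ] E →L[ℝ] ℝ} {S : Set ℝ} {t : ℝ} (hG : IsMetricFamilyOn G' S V)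
include hG

/-- **The trace vector field of `Π = ∂_t Γ` is `W_h = (div_G h)^♯ − ½ ∇ tr_G h`** with
`h = ∂_t G` (Besse 1987, Thm. 1.174 (a) traced). [cite: Besse1987, Thm. 1.174 (a)] -/
theorem varChrTrace_eq_linScalVec (hx : x ∈ V) (ht : t ∈ S) :
    varChrTrace b G' S t x = linScalVec b (G' t) (tDeriv G' S t) x := by
  have hGt := hG.isMetricOn t ht
  have hi := hGt.isInvertible x hx
  have hforms : G' t x (varChrTrace b G' S t x) = G' t x (linScalVec b (G' t) (tDeriv G' S t) x) := by
    ext Z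
    rw [hG.apply_varChrTrace b hx ht Z, linScalVec, map_sub, map_smul, _root_.sub_apply,
      _root_.smul_apply, apply_divFormVec b hi, apply_sharpAt_apply hi, smul_eq_mul]
  rw [← sharpAt_apply hi (varChrTrace b G' S t x), hforms, sharpAt_apply hi]

/-- **The first variation of the scalar curvature is `DS_G(∂_t G)`** (Besse 1987, Thm. 1.174 (e)):
along a smooth family of metric components, `∂_t S(G_t)(x) = DS_{G_t}(∂_t G_t)(x)` (`linScalAt`).
[cite: Besse1987, Thm. 1.174 (e)] -/
theorem hasDerivWithinAt_scalAt_linScalAt (hx : x ∈ V) (ht : t ∈ S) :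
    HasDerivWithinAt (fun s ↦ scalAt (G' s) x) (linScalAt b (G' t) (tDeriv G' S t) x) S t := by
  refine (hG.hasDerivWithinAt_scalAt_eq b hx ht).congr_deriv ?_
  rw [linScalAt]
  congr 2
  refine divAt_congr' ?_
  filter_upwards [(hG.isOpen ht).mem_nhds hx] with y hy
  exact hG.varChrTrace_eq_linScalVec b hy ht

end IsMetricFamilyOn

end MetricCoord

end Literature.Geometry.Lorentzian

end
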